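import Mathlib.LinearAlgebra.Eigenspace.Pi
import Literature.NumberTheory.EllipticCurves.NewformEigencharacter
import HarnessLib

/-!
# There are finitely many newforms of given level `Γ₁(N)` and weight: newforms on `Γ₁(N)` are
# linearly independent (Diamond–Shurman Thm. 5.8.2 / 5.8.3; Li 1975, Thm. 3)

D-0014 keeps `Literature/` sorry-free by stating cited results as named facts `def X : Prop`.
This sibling file of `Literature.NumberTheory.EllipticCurves.Newforms` is the `Γ₁(N)` twin of
`NewformsLinearIndependenceProofs` + `NewformsFiniteProofs` (which prove
`linearIndependent_newforms0` and `finite_newforms0`): for every level `N ≥ 1` and every weight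
`k ∈ ℤ`,

* `IsNewform1.eq_zero_of_forall_eq_smul_of_cuspCoeff_one_eq_zero` — **multiplicity one for
  simultaneous eigenforms of ALL `T_p` and ALL `⟨d⟩`**: a form `g ∈ S_k(Γ₁(N))` with `T_p g = λ_p g`
  for every prime `p` (`U_p` for `p ∣ N`), `⟨d⟩ g = c_d g` for every unit `d`, and `a₁(g) = 0`
  vanishes — by strong induction on `n` through the `q`-expansion of `T_p` on `Γ₁(N)`
  (`cuspCoeff_heckeT_gamma1` = Diamond–Shurman Prop. 5.2.2(a), (5.3):
  `a_n(T_p g) = a_{pn}(g) + 𝟙_N(p) p^{k-1} a_{n/p}(⟨p⟩ g)`) every coefficient vanishes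
  (Diamond–Shurman §5.8, the computation `a_n(f) = a₁(T_n f)` behind Thm. 5.8.2 / Prop. 5.8.5);
* `IsNewform1.eq_of_forall_cuspCoeff_eq` — **distinct newforms have distinct eigen-systems**:
  two newforms with the same `a_p` at every prime and the same nebentypus values coincide (apply
  the previous item to `g - f`);
* `iSupIndep_iInf_maxGenEigenspace_heckeT_diamondOp` — the joint generalised eigenspaces of the
  commuting family `{T_p}_p ∪ {⟨d⟩}_d` on `S_k(Γ₁(N))` attached to distinct characters are
  independent (Mathlib `Module.End.independent_iInf_maxGenEigenspace_of_forall_mapsTo`;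
  commutation: `heckeT_comm_of_prime`, `heckeT_diamondOp_comm_holds`, `diamondOp_comm` —
  Diamond–Shurman Prop. 5.2.4);
* `linearIndependent_newforms1` — **the newforms in `S_k(Γ₁(N))` are linearly independent**
  (Diamond–Shurman, proof of Thm. 5.8.2, PDF p. 218: "the set of newforms … is linearly
  independent"; `iSupIndep.linearIndependent`);
* `finite_newforms1`, `gammaOneNewformsFinite` — **the set `newforms1 N k` is finite**
  (Diamond–Shurman Thm. 5.8.2: the newforms form an orthogonal basis of the finite-dimensional new
  subspace; Thm. 5.8.3):
  a linearly independent subset of the finite-dimensional `S_k(Γ₁(N))`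
  (`finiteDimensional_cuspForm_gamma1`, Sturm) is finite
  (`LinearIndependent.set_finite_of_isNoetherian`).  `gammaOneNewformsFinite` is quantified exactly
  as the route item `GammaOneNewformsFinite` (FIN34a, stmt-BirchSwinnertonDyer-23839) of
  `Summits/BirchSwinnertonDyer/…/Theses/TameQuarticManinParity.lean`.

No definition, no named fact; theorems only.  Unlike the spanning statement `span_newforms1`
(`NewformsSpanGamma1Proofs`, which needs the Main Lemma, Thm. 5.7.1), linear independence and
finiteness are elementary because `IsNewform1` prescribes the eigenvalues of ALL `T_p` (the `U_p`,
`p ∣ N`, included) and of the diamond operators.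

## References

* F. Diamond, J. Shurman, *A first course in modular forms*, GTM 228, Springer 2005 (held:
  `book:diamond2005-first-course-modular-forms`), Prop. 5.2.2 and (5.3) (PDF p. 171), Prop. 5.2.4,
  Def. 5.8.1, Thm. 5.8.2 and its proof, Thm. 5.8.3 (PDF pp. 216–218). doi:10.1007/978-0-387-27226-9
* W.-C. W. Li, *Newforms and functional equations*, Math. Ann. 212 (1975), 285–315, Thm. 3.
* T. Miyake, *Modular forms*, Springer 1989/2006, Thm. 4.6.13.
-/

noncomputable section

open scoped MatrixGroups ModularForm

open CongruenceSubgroup UpperHalfPlane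

namespace Literature.NumberTheory.EllipticCurves.ModularForms

variable {N : ℕ} [NeZero N] {k : ℤ}

/-! ### Multiplicity one for simultaneous eigenforms of all `T_p` and all `⟨d⟩` -/

/-- **A simultaneous eigenform of all `T_p` and all `⟨d⟩` with `a₁ = 0` vanishes.**  If
`g ∈ S_k(Γ₁(N))` satisfies `T_p g = λ_p g` for every prime `p` (`T_p = U_p` for `p ∣ N`),
`⟨d⟩ g = c_d g` for every `d ∈ (ℤ/Nℤ)ˣ`, and `a₁(g) = 0`, then `g = 0`: for `n = pm ≥ 2`,
`a_{pm}(g) = a_m(T_p g) - 𝟙_N(p) p^{k-1} a_{m/p}(⟨p⟩ g) = λ_p a_m(g) - 𝟙_N(p) p^{k-1} c_p a_{m/p}(g)`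
vanishes by induction (`cuspCoeff_heckeT_gamma1`, Diamond–Shurman (5.3)), so the `q`-expansion of
`g` is `0` (Diamond–Shurman §5.8, proof of Thm. 5.8.2 / Prop. 5.8.5: a normalised eigenform is
determined by its eigenvalues). [cite: DiamondShurman2005, §5.8, proof of Thm. 5.8.2 (PDF p. 218)] -/
theorem eq_zero_of_forall_heckeT_diamondOp_eq_smul_of_cuspCoeff_one_eq_zero
    (g : CuspForm (Gamma1 N) k) (a : ℕ → ℂ) (c : (ZMod N)ˣ → ℂ)
    (hT : ∀ (p : ℕ) (hp : p.Prime),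
      (haveI : NeZero p := ⟨hp.ne_zero⟩; heckeT (Gamma1 N) k p g) = a p • g)
    (hD : ∀ d : (ZMod N)ˣ, diamondOp N k (d : ZMod N) g = c d • g)
    (h1 : cuspCoeff g 1 = 0) : g = 0 := by
  have hΓ := HeckeTGamma1.one_mem_strictPeriods_Gamma1 N
  have hall : ∀ n, cuspCoeff g n = 0 := by
    intro n
    induction n using Nat.strong_induction_on with
    | _ n ih =>
      rcases Nat.lt_or_ge n 2 with hn | hn
      · interval_cases n
        · exact CuspFormClass.qExpansion_coeff_zero g one_pos hΓ
        · exact h1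
      · obtain ⟨p, hp, m, rfl⟩ : ∃ p, p.Prime ∧ ∃ m, n = p * m := by
          obtain ⟨p, hp, hpn⟩ := Nat.exists_prime_and_dvd (show n ≠ 1 by omega)
          exact ⟨p, hp, hpn⟩
        haveI : NeZero p := ⟨hp.ne_zero⟩
        have hm0 : 0 < m := Nat.pos_of_ne_zero (by rintro rfl; simp at hn)
        have hm : m < p * m := lt_mul_left hm0 hp.one_lt
        have key := cuspCoeff_heckeT_gamma1 g p hp m
        rw [hT p hp, cuspCoeff_smul_gamma1, ih m hm, mul_zero] at key
        -- the diamond term vanishes too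
        have hdia : (if p ∣ N then (0 : ℂ)
            else (p : ℂ) ^ (k - 1) * (if p ∣ m then cuspCoeff (diamondOp N k p g) (m / p) else 0))
              = 0 := by
          split_ifs with hpN hpm
          · rfl
          · have hcop : Nat.Coprime p N := (Nat.Prime.coprime_iff_not_dvd hp).mpr hpN
            have hu : ((ZMod.unitOfCoprime p hcop : (ZMod N)ˣ) : ZMod N) = (p : ZMod N) :=
              ZMod.coe_unitOfCoprime p hcop
            rw [← hu, hD, cuspCoeff_smul_gamma1, ih _ ((Nat.div_le_self m p).trans_lt hm),
              mul_zero, mul_zero]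
          · rw [mul_zero]
        rw [hdia, add_zero] at key
        exact key.symm
  have hq : qExpansion 1 ⇑g = 0 := PowerSeries.ext fun n ↦ by
    simpa [cuspCoeff] using hall n
  have hcoe : (⇑g : ℍ → ℂ) = 0 :=
    (qExpansion_eq_zero_iff one_pos (SlashInvariantFormClass.periodic_comp_ofComplex g hΓ)
      (ModularFormClass.holo g) (ModularFormClass.bdd_at_infty g)).1 hq
  exact DFunLike.coe_injective (by simpa using hcoe)

/-- A `Γ₁(N)`-newform is nonzero (`a₁ = 1`). [folklore] -/
private theorem ne_zero_of_isNewform1 {f : CuspForm (Gamma1 N) k} (hf : IsNewform1 f) : f ≠ 0 := by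
  intro h0
  have h1 := hf.cuspCoeff_one
  have hz := cuspCoeff_smul_gamma1 (0 : ℂ) (0 : CuspForm (Gamma1 N) k) 1
  rw [zero_smul, zero_mul] at hz
  rw [h0, hz] at h1
  exact zero_ne_one h1

/-- **Distinct newforms on `Γ₁(N)` have distinct systems of eigenvalues**: if `f, g` are newforms
in `S_k(Γ₁(N))` with `a_p(f) = a_p(g)` for every prime `p` (including `p ∣ N`, where `T_p = U_p`)
and the same nebentypus values `ε_f(d) = ε_g(d)`, `d ∈ (ℤ/Nℤ)ˣ`, then `f = g`: the difference
`g - f` is a simultaneous eigenform with the same eigenvalues and `a₁ = 0`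
(`eq_zero_of_forall_heckeT_diamondOp_eq_smul_of_cuspCoeff_one_eq_zero`) (Diamond–Shurman §5.8,
proof of Thm. 5.8.2: "since `p` is arbitrary this means that `f_i = f_1`").
[cite: DiamondShurman2005, Thm. 5.8.2 (proof, PDF p. 218)] -/
theorem IsNewform1.eq_of_forall_cuspCoeff_eq {f g : CuspForm (Gamma1 N) k}
    (hf : IsNewform1 f) (hg : IsNewform1 g)
    (hT : ∀ p : ℕ, p.Prime → cuspCoeff f p = cuspCoeff g p)
    (hD : ∀ d : (ZMod N)ˣ, nebentypus f (d : ZMod N) = nebentypus g (d : ZMod N)) : f = g := by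
  have h0 : g - f = 0 := by
    refine eq_zero_of_forall_heckeT_diamondOp_eq_smul_of_cuspCoeff_one_eq_zero (g - f)
      (fun p ↦ cuspCoeff f p) (fun d ↦ nebentypus f (d : ZMod N)) (fun p hp ↦ ?_) (fun d ↦ ?_) ?_
    · haveI : NeZero p := ⟨hp.ne_zero⟩
      rw [map_sub, hf.heckeT_apply_eq_cuspCoeff_smul p hp, hg.heckeT_apply_eq_cuspCoeff_smul p hp,
        hT p hp, smul_sub]
    · rw [map_sub, hf.diamondOp_apply_eq_smul d, hg.diamondOp_apply_eq_smul d, hD d, smul_sub]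
    · rw [cuspCoeff_sub_gamma1, hf.cuspCoeff_one, hg.cuspCoeff_one, sub_self]
  exact (sub_eq_zero.mp h0).symm

/-! ### Simultaneous generalised eigenspaces of the `T_p` and `⟨d⟩` -/

/-- The family `{T_p : p prime} ∪ {⟨d⟩ : d ∈ (ℤ/Nℤ)ˣ}` on `S_k(Γ₁(N))`, indexed by
`Nat.Primes ⊕ (ℤ/Nℤ)ˣ` through `Sum.elim`, is pairwise commuting (Diamond–Shurman Prop. 5.2.4:
`heckeT_comm_of_prime`, `heckeT_diamondOp_comm_holds`, `diamondOp_comm`). [cite: DiamondShurman2005, Prop. 5.2.4] -/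
theorem commute_sumElim_heckeT_diamondOp (i j : Nat.Primes ⊕ (ZMod N)ˣ) :
    Commute
      (Sum.elim (fun p : Nat.Primes ↦ haveI : NeZero (p : ℕ) := ⟨p.2.ne_zero⟩; heckeT (Gamma1 N) k p)
        (fun d : (ZMod N)ˣ ↦ diamondOp N k (d : ZMod N)) i)
      (Sum.elim (fun p : Nat.Primes ↦ haveI : NeZero (p : ℕ) := ⟨p.2.ne_zero⟩; heckeT (Gamma1 N) k p)
        (fun d : (ZMod N)ˣ ↦ diamondOp N k (d : ZMod N)) j) := by
  rcases i with p | d <;> rcases j with q | e <;> simp only [Sum.elim_inl, Sum.elim_inr]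
  · haveI : NeZero (p : ℕ) := ⟨p.2.ne_zero⟩
    haveI : NeZero (q : ℕ) := ⟨q.2.ne_zero⟩
    exact heckeT_comm_of_prime p.2 q.2 k
  · haveI : NeZero (p : ℕ) := ⟨p.2.ne_zero⟩
    exact heckeT_diamondOp_comm_holds N k p (e : ZMod N)
  · haveI : NeZero (q : ℕ) := ⟨q.2.ne_zero⟩
    exact (heckeT_diamondOp_comm_holds N k q (d : ZMod N)).symm
  · exact diamondOp_comm N k (d : ZMod N) (e : ZMod N)

/-- **Independence of the joint generalised eigenspaces** of the commuting family
`{T_p : p prime} ∪ {⟨d⟩ : d unit}` on `S_k(Γ₁(N))`: for distinct characters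
`χ : Nat.Primes ⊕ (ℤ/Nℤ)ˣ → ℂ` the subspaces `⋂_i {v : (F_i - χ(i))^∞ v = 0}` are independent —
linear algebra for a commuting family (Mathlib
`Module.End.independent_iInf_maxGenEigenspace_of_forall_mapsTo`; Diamond–Shurman Prop. 5.2.4 for
the commutation). [cite: DiamondShurman2005, Prop. 5.2.4] -/
theorem iSupIndep_iInf_maxGenEigenspace_heckeT_diamondOp :
    iSupIndep fun χ : Nat.Primes ⊕ (ZMod N)ˣ → ℂ ↦
      ⨅ i, Module.End.maxGenEigenspace
        (Sum.elim (fun p : Nat.Primes ↦ haveI : NeZero (p : ℕ) := ⟨p.2.ne_zero⟩; heckeT (Gamma1 N) k p)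
          (fun d : (ZMod N)ˣ ↦ diamondOp N k (d : ZMod N)) i) (χ i) :=
  Module.End.independent_iInf_maxGenEigenspace_of_forall_mapsTo _
    fun i j φ ↦ Module.End.mapsTo_maxGenEigenspace_of_comm
      (commute_sumElim_heckeT_diamondOp j i) φ

/-- A newform `f` lies in the joint (generalised) eigenspace of the family `{T_p} ∪ {⟨d⟩}` for its
own character `(a_p(f))_p ⊔ (ε_f(d))_d` (`T_p f = a_p(f) f`, `⟨d⟩ f = ε_f(d) f`; Diamond–Shurman
Def. 5.8.1, Prop. 5.8.5). [cite: DiamondShurman2005, Def. 5.8.1 and Prop. 5.8.5] -/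
theorem IsNewform1.mem_iInf_maxGenEigenspace {f : CuspForm (Gamma1 N) k}
    (hf : IsNewform1 f) :
    f ∈ ⨅ i, Module.End.maxGenEigenspace
        (Sum.elim (fun p : Nat.Primes ↦ haveI : NeZero (p : ℕ) := ⟨p.2.ne_zero⟩; heckeT (Gamma1 N) k p)
          (fun d : (ZMod N)ˣ ↦ diamondOp N k (d : ZMod N)) i)
        (Sum.elim (fun p : Nat.Primes ↦ cuspCoeff f p) (fun d : (ZMod N)ˣ ↦ nebentypus f (d : ZMod N)) i) := by
  refine (Submodule.mem_iInf _).mpr fun i ↦ Module.End.eigenspace_le_maxGenEigenspace ?_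
  rw [Module.End.mem_eigenspace_iff]
  rcases i with p | d <;> simp only [Sum.elim_inl, Sum.elim_inr]
  · haveI : NeZero (p : ℕ) := ⟨p.2.ne_zero⟩
    exact hf.heckeT_apply_eq_cuspCoeff_smul p p.2
  · exact hf.diamondOp_apply_eq_smul d

/-! ### Linear independence and finiteness -/

variable (N k) in
/-- **Newforms on `Γ₁(N)` are linearly independent** (Diamond–Shurman Thm. 5.8.2, proof, PDF
p. 218: "the set of newforms … is linearly independent"; Thm. 5.8.3; Li 1975, Thm. 3), for every
level `N ≥ 1` and weight `k`: newforms are nonzero vectors in the joint eigenspaces of the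
commuting family `{T_p}_p ∪ {⟨d⟩}_d` attached to pairwise distinct characters
(`IsNewform1.eq_of_forall_cuspCoeff_eq`), and such vectors are linearly independent
(`iSupIndep_iInf_maxGenEigenspace_heckeT_diamondOp`, `iSupIndep.linearIndependent`).
[cite: DiamondShurman2005, Thm. 5.8.2 (proof, PDF p. 218)] [cite: Li1975, Thm. 3] -/
theorem linearIndependent_newforms1 :
    LinearIndependent ℂ (Subtype.val : newforms1 N k → CuspForm (Gamma1 N) k) := by
  have hind := (iSupIndep_iInf_maxGenEigenspace_heckeT_diamondOp (N := N) (k := k)).comp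
    (f := fun f : newforms1 N k ↦
      Sum.elim (fun p : Nat.Primes ↦ cuspCoeff (f : CuspForm (Gamma1 N) k) p)
        (fun d : (ZMod N)ˣ ↦ nebentypus (f : CuspForm (Gamma1 N) k) (d : ZMod N)))
    (fun f g hfg ↦ Subtype.ext <|
      IsNewform1.eq_of_forall_cuspCoeff_eq (show IsNewform1 f.1 from f.2)
        (show IsNewform1 g.1 from g.2)
        (fun p hp ↦ by simpa using congr_fun hfg (Sum.inl ⟨p, hp⟩))
        (fun d ↦ by simpa using congr_fun hfg (Sum.inr d)))
  exact hind.linearIndependent _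
    (fun f ↦ IsNewform1.mem_iInf_maxGenEigenspace (show IsNewform1 f.1 from f.2))
    (fun f ↦ ne_zero_of_isNewform1 (show IsNewform1 f.1 from f.2))

/-- Corollary: any family of pairwise distinct `Γ₁(N)`-newforms is linearly independent
(reindexing of `linearIndependent_newforms1`; Diamond–Shurman Thm. 5.8.2, proof).
[cite: DiamondShurman2005, Thm. 5.8.2 (proof, PDF p. 218)] -/
theorem linearIndependent_of_isNewform1 {ι : Type*} {v : ι → CuspForm (Gamma1 N) k}
    (hv : ∀ i, IsNewform1 (v i)) (hinj : Function.Injective v) : LinearIndependent ℂ v :=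
  (linearIndependent_newforms1 N k).comp (fun i ↦ (⟨v i, hv i⟩ : newforms1 N k))
    fun _ _ hij ↦ hinj (congrArg Subtype.val hij)

variable (N k) in
/-- **There are finitely many newforms of level `Γ₁(N)` and weight `k`** (Diamond–Shurman
Thm. 5.8.2, PDF p. 217: "The set of newforms in the space `S_k(Γ₁(N))^{new}` is an orthogonal basis
of the space"; Thm. 5.8.3, PDF p. 218: `{f(nτ) : f newform of level M, nM ∣ N}` is a basis of
`S_k(Γ₁(N))`; Miyake Thm. 4.6.13): a linearly independent subset (`linearIndependent_newforms1`) of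
the finite-dimensional space `S_k(Γ₁(N))` (`finiteDimensional_cuspForm_gamma1`, Sturm's bound) is
finite. [cite: DiamondShurman2005, Thm. 5.8.2 (PDF p. 217) and Thm. 5.8.3 (PDF p. 218)] -/
theorem finite_newforms1 : (newforms1 N k).Finite := by
  haveI := finiteDimensional_cuspForm_gamma1 N k
  exact (linearIndependent_newforms1 N k).set_finite_of_isNoetherian

variable (N k) in
/-- The `Γ₁(N)`-newforms of weight `k` as a `Finset`: the coercion of
`(finite_newforms1 N k).toFinset` is `newforms1 N k` (finiteness: Diamond–Shurman Thm. 5.8.2).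
[cite: DiamondShurman2005, Thm. 5.8.2 (PDF p. 217)] -/
theorem coe_toFinset_newforms1 :
    ((finite_newforms1 N k).toFinset : Set (CuspForm (Gamma1 N) k)) = newforms1 N k :=
  Set.Finite.coe_toFinset _

/-- **Finiteness of `Γ₁`-newforms, quantified as the route item** `GammaOneNewformsFinite`
(FIN34a, stmt-BirchSwinnertonDyer-23839 of
`Summits/BirchSwinnertonDyer/…/Theses/TameQuarticManinParity.lean`): for every level `M ≥ 1` and
weight `k`, `newforms1 M k` is finite (Diamond–Shurman Thm. 5.8.2: the newforms are an orthogonal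
basis of the finite-dimensional new subspace). The by-name close of the item is the one-liner
`gammaOneNewformsFinite`. [cite: DiamondShurman2005, Thm. 5.8.2 (PDF p. 217)] -/
theorem gammaOneNewformsFinite : ∀ (M : ℕ) [NeZero M] (k : ℤ), (newforms1 M k).Finite :=
  fun M _ k ↦ finite_newforms1 M k

end Literature.NumberTheory.EllipticCurves.ModularForms

end
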